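import Summits.CriticalPhenomena.PercolationContinuityZ3.Theorems.PercNearOneGluingNoHeavyPcintKernNFZ4S8Check1
import Summits.CriticalPhenomena.PercolationContinuityZ3.Theorems.PercNearOneGluingNoHeavyPcintKernNFZ4S8Check2
import Summits.CriticalPhenomena.PercolationContinuityZ3.Theorems.PercNearOneGluingNoHeavyPcintKernNFZ4S8Check3
import Summits.CriticalPhenomena.PercolationContinuityZ3.Theorems.PercNearOneGluingNoHeavyPcintKernNFZ4S8Check4
import Summits.CriticalPhenomena.PercolationContinuityZ3.Theorems.PercNearOneGluingNoHeavyPcintKernNFZ4S8Check5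
import Summits.CriticalPhenomena.PercolationContinuityZ3.Theorems.PercNearOneGluingNoHeavyPcintKernNFZ4S8Check6
import Summits.CriticalPhenomena.PercolationContinuityZ3.Theorems.PercNearOneGluingNoHeavyPcintKernNFZ4S8Check7
import Summits.CriticalPhenomena.PercolationContinuityZ3.Theorems.PercNearOneGluingNoHeavyPcintKernNFZ4S8Check8
import Summits.CriticalPhenomena.PercolationContinuityZ3.Theorems.PercNearOneGluingNoHeavyPcintKernNFZ4S8Check9
import Summits.CriticalPhenomena.PercolationContinuityZ3.Theorems.PercNearOneGluingNoHeavyPcintKernNFZ4S8Check10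
import Summits.CriticalPhenomena.PercolationContinuityZ3.Theorems.PercNearOneGluingNoHeavyPcintKernNFZ4S8Check11
import Summits.CriticalPhenomena.PercolationContinuityZ3.Theorems.PercNearOneGluingNoHeavyPcintKernNFZ4S8Check12
import Summits.CriticalPhenomena.PercolationContinuityZ3.Theorems.PercNearOneGluingNoHeavyPcintKernNFZ4S8Check13
import Summits.CriticalPhenomena.PercolationContinuityZ3.Theorems.PercNearOneGluingNoHeavyPcintKernNFZ4S8Check14
import Summits.CriticalPhenomena.PercolationContinuityZ3.Theorems.PercNearOneGluingNoHeavyPcintKernNFZ4S8Check15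
import Summits.CriticalPhenomena.PercolationContinuityZ3.Theorems.PercNearOneGluingNoHeavyPcintKernNFZ4S8Check16
import Summits.CriticalPhenomena.PercolationContinuityZ3.Theorems.PercNearOneGluingNoHeavyPcintKernNFZ4S8Check17
import Summits.CriticalPhenomena.PercolationContinuityZ3.Theorems.PercNearOneGluingNoHeavyPcintKernNFZ4S8Check18
import Summits.CriticalPhenomena.PercolationContinuityZ3.Theorems.PercNearOneGluingNoHeavyPcintKernNFZ4S8Check19
import Summits.CriticalPhenomena.PercolationContinuityZ3.Theorems.PercNearOneGluingNoHeavyPcintKernNFZ4S8Check20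
import Summits.CriticalPhenomena.PercolationContinuityZ3.Theorems.PercNearOneGluingNoHeavyPcintKernNFZ4S8Check21
import Summits.CriticalPhenomena.PercolationContinuityZ3.Theorems.PercNearOneGluingNoHeavyPcintKernNFZ4S8Check22
import Summits.CriticalPhenomena.PercolationContinuityZ3.Theorems.PercNearOneGluingNoHeavyPcintKernNFZ4S8Check23
import Summits.CriticalPhenomena.PercolationContinuityZ3.Theorems.PercNearOneGluingNoHeavyPcintKernNFZ4S8Check24
import Summits.CriticalPhenomena.PercolationContinuityZ3.Theorems.PercNearOneGluingNoHeavyPcintKernNFZ4S8Check25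
import Summits.CriticalPhenomena.PercolationContinuityZ3.Theorems.PercNearOneGluingNoHeavyPcintKernNFZ4S8Check26
import Summits.CriticalPhenomena.PercolationContinuityZ3.Theorems.PercNearOneGluingNoHeavyPcintKernNFZ4S8Check27
import Summits.CriticalPhenomena.PercolationContinuityZ3.Theorems.PercNearOneGluingNoHeavyPcintKernNFZ4S8Check28
import Summits.CriticalPhenomena.PercolationContinuityZ3.Theorems.PercNearOneGluingNoHeavyPcintKernNFZ4S8Check29
import Summits.CriticalPhenomena.PercolationContinuityZ3.Theorems.PercNearOneGluingNoHeavyPcintKernNFZ4S8Check30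
import HarnessLib

/-!
# PCINT lane: `p_c^site(ℤ⁴) ≥ 0.1677` (kernel-checked B2r window certificate on normal forms, memory 8 (7-step windows; 9696 first-use normal forms of 2097152 codes); printed lower bound = the bond one).

Cell `prim-pcint`, seat `prim-pcint-2` (gen 2); memo `run/shared/lean/prim/pcint/INTERVAL-PLAN.md` §15.  Does NOT build on p205010.
Assembles the kernel-checked row blocks (`…KernNFZ4S8Check1..30`) — rows read from the search tree, converted once by `WinK.all_rowOKSK_of_tree` after checking `ordered` and `toList = tbl` by `decide`, closes the enumeration (`WinK.all_nfCodes_of_nfCodesIn`,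
`WinK.allRange_nfOKS_of_nfCodes`) and applies `WinK.le_siteCriticalProb_of_checkSK` (`…PcintWinKernelSymCert`).
No external certificate, no `native_decide`; axioms standard.
-/

namespace Summit.CriticalPhenomena.PercolationContinuityZ3.Theorems.Pcint

open Literature.Probability.Percolation Literature.Probability.LatticeModels NFZ4S8

set_option maxHeartbeats 0 in
/-- All Collatz–Wielandt rows on the normal forms of the `2097152` window codes check. [folklore] -/
theorem NFZ4S8.chkAll : (WinK.nfCodes 4 7).all (WinK.rowOKSK 4 6 1677 9742 99999 tbl 51200) = true :=
  WinK.all_nfCodes_of_nfCodesIn (hi := 2097152) (WinK.all_of_allB (fuel := 20) (by decide +kernel))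
    (WinK.all_rowOKSK_of_tree (t := WinK.KT.ofListF 12 tbl) (by decide +kernel) (by decide +kernel) (WinK.all_nfCodesIn_append (WinK.all_nfCodesIn_append (WinK.all_nfCodesIn_append (WinK.all_nfCodesIn_append (WinK.all_nfCodesIn_append (WinK.all_nfCodesIn_append (WinK.all_nfCodesIn_append (WinK.all_nfCodesIn_append (WinK.all_nfCodesIn_append (WinK.all_nfCodesIn_append (WinK.all_nfCodesIn_append (WinK.all_nfCodesIn_append (WinK.all_nfCodesIn_append (WinK.all_nfCodesIn_append (WinK.all_nfCodesIn_append (WinK.all_nfCodesIn_append (WinK.all_nfCodesIn_append (WinK.all_nfCodesIn_append (WinK.all_nfCodesIn_append (WinK.all_nfCodesIn_append (WinK.all_nfCodesIn_append (WinK.all_nfCodesIn_append (WinK.all_nfCodesIn_append (WinK.all_nfCodesIn_append (WinK.all_nfCodesIn_append (WinK.all_nfCodesIn_append (WinK.all_nfCodesIn_append (WinK.all_nfCodesIn_append (WinK.all_nfCodesIn_append chkFile_1 chkFile_2) chkFile_3) chkFile_4) chkFile_5) chkFile_6) chkFile_7) chkFile_8) chkFile_9) chkFile_10) chkFile_11)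 chkFile_12) chkFile_13) chkFile_14) chkFile_15) chkFile_16) chkFile_17) chkFile_18) chkFile_19) chkFile_20) chkFile_21) chkFile_22) chkFile_23) chkFile_24) chkFile_25) chkFile_26) chkFile_27) chkFile_28) chkFile_29) chkFile_30))

/-- **`p_c^site(ℤ⁴) ≥ 0.1677`** (kernel-checked B2r window certificate on normal forms, memory 8 (7-step windows; 9696 first-use normal forms of 2097152 codes); printed lower bound = the bond one). [folklore] -/
theorem siteCriticalProb_Z4_ge_01677 : (0.1677 : ℝ) ≤ siteCriticalProb (zdGraph 4) 0 := by
  have h := WinK.le_siteCriticalProb_of_checkSK (d := 4) (m := 6) (pn := 1677) (Q := 9742) (lamN := 99999)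
      (tbl := tbl) (dflt := 51200) (vlo := 51200) (vhi := 100000) (by norm_num) (by norm_num) (by norm_num) (by norm_num)
      (by norm_num) tbl_bounds (by norm_num) (by norm_num)
      (WinK.allRange_nfOKS_of_nfCodes chkAll)
  have e : ((1677 : ℕ) : ℝ) / 10 ^ 4 = 0.1677 := by norm_num
  rw [e] at h
  exact h

end Summit.CriticalPhenomena.PercolationContinuityZ3.Theorems.Pcint
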